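import Summits.CriticalPhenomena.PercolationContinuityZ3.Theorems.PercNearOneGluingNoHeavyQuantCherryCombRow
import Summits.CriticalPhenomena.PercolationContinuityZ3.Theorems.PercNearOneGluingNoHeavyQuantFarTreeBlockCombStrong
import HarnessLib

/-!
# QUANT lane R8, FAR on trees beyond block-combs: the cherry-comb row in GATE COORDINATES (product Bernoulli gates; the stemmed canonical
# model of `…QuantCherryCombModels` identified with the relay count of an explicit block-comb carrying unit cherries / two-relay hairs)

builds on p205010 (kernel theorem, internal audit signed; external expert review pending)

Support file (`--supports stmt-CriticalPhenomena-4575`), QUANT lane seat prim-quant-p1 (gen 10); memo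
`run/shared/lean/prim/quant/P1-SURPLUS.md` §21.  Theorems only, no sorries, standard axioms.  Pattern: p1 g8's `…QuantFarTreeBlockCombStrong.lean`
(`Quant.BlockCombGate.real_heavy_eq_tail`), with the stem clause added.

**Setting (explicit stemmed block-comb on a product space).**  Independent gates `q : E → [0,1]` on a finite coordinate type `E`; a CHAIN
`ch : Fin D → E` (injective); PIECES `k : κ` with pairwise disjoint private gate sets `G k ⊆ E` off the chain, a level `lv k ≤ D`, a class size `a k`
and a stem `st k : κ`.  Piece `k` is REACHED in `ω` when the chain prefix `ch 0, …, ch (lv k − 1)`, all of `G k` AND all of `G (st k)` lie in `ω`;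
it then contributes `a k` relays.  Blobs (`st k = k`) are the glued classes of a block-comb; a unit cherry `(s₀; ℓ₁, ℓ₂)` (stem of size `0`, two
leaves of equal size) is a relay-free vertex `s₀` hanging at the chain by the private path `G s₀` and carrying two classes of `m` relays on the
further private paths `G ℓ₁`, `G ℓ₂`; a unit two-relay hair is the cherry with `G ℓ₁ = ∅`.  This is `Quant.FarTreeRow`'s setting with ancestor
finsets `P b = ch''{i < lv k} ∪ G (st k) ∪ G k` for the relays `b` of class `k`.

* `Quant.CherryCombGate.real_pieceCount_eq_sum` — reading the pieces (block principle `prodBernoulli_real_preimage_readBlocks`): the probability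
  that the pieces with `lv k ≤ i`, `G k ⊆ ω`, `G (st k) ⊆ ω` carry `≥ j+1` relays is the finite sum `Σ_S wt S·𝟙[j+1 ≤ massSt_i S]`.
* `Quant.CherryCombGate.tailSt_succ` — the stemmed tail one chain gate longer.
* `Quant.CherryCombGate.real_heavy_eq_tailSt` — **identification**: `P(#reached relays ≥ j+1) = TAILst[D, q ∘ ch, lv, a, ∏_{G k} q, st, j]`
  (induction on `D`, conditioning on the top chain gate with `Quant.prodBernoulli_real_gate_split`).
* `Quant.CherryCombGate.farTree_cherryComb_of_mean` — **THE CHERRY-COMB ROW, gate coordinates**: stems stemless with the level of their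
  leaves, every leaf in a unit cherry (stem of size `0`, exactly one partner leaf of the same size); if `2j < Σ_k a k·marginal k` (marginal of a
  blob `= (∏_{i<lv k} q(ch i))·∏_{G k} q`, of a leaf `= (∏_{i<lv k} q(ch i))·(∏_{G (st k)} q)·∏_{G k} q`) and `1 − marginal k ≤ t` for every live
  piece, then `P(#reached relays ≤ j) ≤ t` (`Quant.CherryComb.tail_ge_of_cherryComb`).
Route vocabulary (bond weights on `Sym2 (Fin n)`, `Quant.tree_relayCount_transfer`): `…QuantFarRelayRowCherryComb.lean` (same seat).
[this work]; product measure [cite: Grimmett1999, §1.3 p. 10].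
-/

noncomputable section

namespace Summit.CriticalPhenomena.PercolationContinuityZ3.Theorems

namespace Quant

namespace CherryCombGate

open Finset MeasureTheory
open Literature.Probability.LatticeModels
open Literature.Probability.Percolation
open scoped Classical

variable {E : Type*} [Fintype E] [DecidableEq E] {κ : Type*} [Fintype κ] [DecidableEq κ]

/-- product weight of a set of open pieces (canonical model of `…QuantCherryCombModels`) -/
local notation3 "wt[" g ", " S "]" => ∏ k, (if k ∈ (S : Finset κ) then (g : κ → ℝ) k else 1 - (g : κ → ℝ) k)
/-- depth law of the chain -/
local notation3 "pd[" D ", " q ", " i "]" =>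
  (∏ i' ∈ Finset.range (i : ℕ), (q : ℕ → ℝ) i') * (if (i : ℕ) < (D : ℕ) then 1 - (q : ℕ → ℝ) i else 1)
/-- mass counted at depth `i`, stemmed model -/
local notation3 "massSt[" lv ", " a ", " st ", " i ", " S "]" =>
  ∑ k ∈ (S : Finset κ).filter (fun k => (lv : κ → ℕ) k ≤ (i : ℕ) ∧ (st : κ → κ) k ∈ (S : Finset κ)), ((a : κ → ℕ) k : ℕ)
/-- the stemmed tail -/
local notation3 "TAILst[" D ", " q ", " lv ", " a ", " g ", " st ", " j "]" =>
  ∑ i ∈ Finset.range ((D : ℕ) + 1), pd[D, q, i] *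
    ∑ S : Finset κ, wt[g, S] * (if (j : ℕ) + 1 ≤ massSt[lv, a, st, i, S] then (1 : ℝ) else 0)

/-! ### 1. Reading the pieces -/

/-- **Block reading, stemmed count.**  For pairwise disjoint gate sets `G k`, the probability under `prodBernoulli q` that the pieces `k` with
`lv k ≤ i`, `G k ⊆ ω` and `G (st k) ⊆ ω` carry at least `j+1` relays is the canonical stemmed sum with piece gates `∏_{e ∈ G k} q e`. [this work] -/
theorem real_pieceCount_eq_sum (q : E → unitInterval) (G : κ → Finset E)
    (hGdisj : ∀ k k', k ≠ k' → Disjoint (G k) (G k')) (lv : κ → ℕ) (a : κ → ℕ) (st : κ → κ) (i j : ℕ) :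
    (prodBernoulli q).real {ω : Set E | j + 1 ≤ ∑ k ∈ Finset.univ.filter
        (fun k => lv k ≤ i ∧ ((G k : Finset E) : Set E) ⊆ ω ∧ ((G (st k) : Finset E) : Set E) ⊆ ω), a k} =
      ∑ S : Finset κ, wt[(fun k => ∏ e ∈ G k, (q e : ℝ)), S] *
        (if j + 1 ≤ massSt[lv, a, st, i, S] then (1 : ℝ) else 0) := by
  rcases isEmpty_or_nonempty κ with hκ | hκ
  · -- no pieces: both sides are `𝟙[j+1 ≤ 0] = 0`
    have hL : {ω : Set E | j + 1 ≤ ∑ k ∈ Finset.univ.filter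
        (fun k => lv k ≤ i ∧ ((G k : Finset E) : Set E) ⊆ ω ∧ ((G (st k) : Finset E) : Set E) ⊆ ω), a k} = ∅ := by
      ext ω
      simp only [Finset.univ_eq_empty, Finset.filter_empty, Finset.sum_empty, Set.mem_setOf_eq,
        Set.mem_empty_iff_false, iff_false, not_le]
      exact Nat.succ_pos j
    rw [hL, measureReal_empty]
    symm
    refine Finset.sum_eq_zero fun S _ => ?_
    have : ¬ (j + 1 ≤ massSt[lv, a, st, i, S]) := by
      have hS : S = ∅ := Finset.eq_empty_of_isEmpty S
      subst hS; simp
    rw [if_neg this, mul_zero]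
  obtain ⟨k₀⟩ := hκ
  -- blocks: the piece of a private gate, `k₀` for every other coordinate
  set blk : E → κ := fun e => if h : ∃ k, e ∈ G k then Classical.choose h else k₀ with hblk
  have hblkG : ∀ k, ∀ e ∈ G k, blk e = k := by
    intro k e he
    have h : ∃ k, e ∈ G k := ⟨k, he⟩
    have hc := Classical.choose_spec h
    simp only [hblk, dif_pos h]
    by_contra hne
    exact Finset.disjoint_left.1 (hGdisj _ _ hne) hc he
  set g : κ → Set E → Prop := fun k ω => ((G k : Finset E) : Set E) ⊆ ω with hg
  have hloc : IsBlockLocal blk g := by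
    intro k ω ω' hagree
    simp only [hg, Set.subset_def, Finset.mem_coe]
    exact forall_congr' fun e => imp_congr_right fun he => hagree e (hblkG k e he)
  have hmeas : ∀ k, Measurable (g k) := fun k => Measurable.of_discrete
  set q' : κ → unitInterval := fun k => ⟨(prodBernoulli q).real {ω | g k ω}, measureReal_nonneg, measureReal_le_one⟩ with hq'
  have hq'val : ∀ k, ((q' k : unitInterval) : ℝ) = ∏ e ∈ G k, (q e : ℝ) := by
    intro k
    show (prodBernoulli q).real {ω | g k ω} = _
    simp only [hg]
    rw [prodBernoulli_real_subset]
  have hq : ∀ k, (prodBernoulli q).real {ω | g k ω} = q' k := fun k => rfl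
  set T : Set (Set κ) := {W : Set κ | j + 1 ≤ ∑ k ∈ Finset.univ.filter (fun k => lv k ≤ i ∧ k ∈ W ∧ st k ∈ W), a k} with hT
  have hpre : {ω : Set E | j + 1 ≤ ∑ k ∈ Finset.univ.filter
        (fun k => lv k ≤ i ∧ ((G k : Finset E) : Set E) ⊆ ω ∧ ((G (st k) : Finset E) : Set E) ⊆ ω), a k} =
      (fun ω => {k | g k ω}) ⁻¹' T := by
    ext ω
    simp only [hT, hg, Set.mem_setOf_eq, Set.mem_preimage]
  rw [hpre, prodBernoulli_real_preimage_readBlocks q blk hloc hmeas q' hq MeasurableSet.of_discrete,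
    IndepBlob.prodBernoulli_real_eq_sum_finset, Finset.sum_filter]
  refine Finset.sum_congr rfl fun S _ => ?_
  have hmem : ((S : Finset κ) : Set κ) ∈ T ↔ j + 1 ≤ massSt[lv, a, st, i, S] := by
    simp only [hT, Set.mem_setOf_eq, Finset.mem_coe]
    have hf : Finset.univ.filter (fun k => lv k ≤ i ∧ k ∈ S ∧ st k ∈ S) = S.filter (fun k => lv k ≤ i ∧ st k ∈ S) := by
      ext k; simp only [Finset.mem_filter, Finset.mem_univ, true_and]; tauto
    rw [hf]
  have hwt : (∏ k, (if k ∈ S then ((q' k : unitInterval) : ℝ) else 1 - ((q' k : unitInterval) : ℝ))) =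
      wt[(fun k => ∏ e ∈ G k, (q e : ℝ)), S] := by
    refine Finset.prod_congr rfl fun k _ => ?_
    rw [hq'val]
  by_cases h : ((S : Finset κ) : Set κ) ∈ T
  · rw [if_pos h, if_pos (hmem.1 h), hwt, mul_one]
  · rw [if_neg h, if_neg (fun h' => h (hmem.2 h')), mul_zero]

/-! ### 2. The stemmed tail, one chain gate longer -/

/-- `TAILst[D+1, q] = (1 − q 0)·(mass at depth 0) + q 0 · TAILst[D, q ∘ succ]` (levels shifted down). [this work] -/
theorem tailSt_succ (D : ℕ) (qc : ℕ → ℝ) (lv : κ → ℕ) (a : κ → ℕ) (g : κ → ℝ) (st : κ → κ) (j : ℕ) :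
    TAILst[D + 1, qc, lv, a, g, st, j] =
      (1 - qc 0) * (∑ S : Finset κ, wt[g, S] * (if j + 1 ≤ massSt[lv, a, st, 0, S] then (1 : ℝ) else 0)) +
        qc 0 * TAILst[D, (fun i => qc (i + 1)), (fun k => lv k - 1), a, g, st, j] := by
  rw [Finset.sum_range_succ', add_comm]
  congr 1
  · have : pd[D + 1, qc, 0] = 1 - qc 0 := by
      show (∏ i' ∈ Finset.range 0, qc i') * (if 0 < D + 1 then 1 - qc 0 else 1) = 1 - qc 0
      rw [Finset.prod_range_zero, one_mul, if_pos (Nat.succ_pos D)]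
    rw [this]
  · rw [Finset.mul_sum]
    refine Finset.sum_congr rfl fun i hi => ?_
    have hpd : pd[D + 1, qc, i + 1] = qc 0 * pd[D, (fun i => qc (i + 1)), i] := by
      show (∏ i' ∈ Finset.range (i + 1), qc i') * (if i + 1 < D + 1 then 1 - qc (i + 1) else 1) =
        qc 0 * ((∏ i' ∈ Finset.range i, qc (i' + 1)) * (if i < D then 1 - qc (i + 1) else 1))
      rw [Finset.prod_range_succ']
      by_cases hi' : i < D
      · rw [if_pos hi', if_pos (by omega)]; ring
      · rw [if_neg hi', if_neg (by omega)]; ring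
    have hmass : ∀ S : Finset κ, massSt[lv, a, st, i + 1, S] = massSt[(fun k => lv k - 1), a, st, i, S] := by
      intro S
      refine Finset.sum_congr ?_ fun _ _ => rfl
      ext k
      simp only [Finset.mem_filter]
      constructor
      · rintro ⟨hk, hle, hs⟩; exact ⟨hk, by omega, hs⟩
      · rintro ⟨hk, hle, hs⟩; exact ⟨hk, by omega, hs⟩
    rw [hpd, mul_assoc]
    congr 1
    congr 1
    exact Finset.sum_congr rfl fun S _ => by rw [hmass S]

/-! ### 3. Identification of the relay count with the stemmed canonical model -/

/-- **Identification.**  With chain `ch : Fin D → E` (injective, off the pieces), pieces `G` (pairwise disjoint) at levels `lv k ≤ D` with stems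
`st`, the probability that the reached pieces carry `≥ j+1` relays equals the stemmed canonical tail with chain gates `q (ch i)`, sizes `a`, stems
`st` and piece gates `∏_{G k} q`.  Induction on `D`, conditioning on the top chain gate (`Quant.prodBernoulli_real_gate_split`). [this work] -/
theorem real_heavy_eq_tailSt : ∀ (D : ℕ) (q : E → unitInterval) (ch : Fin D → E), Function.Injective ch →
    ∀ (G : κ → Finset E), (∀ k k', k ≠ k' → Disjoint (G k) (G k')) → (∀ k (i : Fin D), ch i ∉ G k) →
    ∀ (lv : κ → ℕ), (∀ k, lv k ≤ D) → ∀ (a : κ → ℕ) (st : κ → κ) (j : ℕ),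
    (prodBernoulli q).real {ω : Set E | j + 1 ≤ ∑ k ∈ Finset.univ.filter
        (fun k => (∀ i : Fin D, (i : ℕ) < lv k → ch i ∈ ω) ∧ ((G k : Finset E) : Set E) ⊆ ω ∧
          ((G (st k) : Finset E) : Set E) ⊆ ω), a k} =
      TAILst[D, (fun i => if h : i < D then ((q (ch ⟨i, h⟩) : unitInterval) : ℝ) else 1), lv, a,
        (fun k => ∏ e ∈ G k, (q e : ℝ)), st, j] := by
  intro D
  induction D with
  | zero =>
    intro q ch hch G hGdisj hGch lv hlv a st j
    have hlv0 : ∀ k, lv k = 0 := fun k => Nat.le_zero.1 (hlv k)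
    have hev : {ω : Set E | j + 1 ≤ ∑ k ∈ Finset.univ.filter
        (fun k => (∀ i : Fin 0, (i : ℕ) < lv k → ch i ∈ ω) ∧ ((G k : Finset E) : Set E) ⊆ ω ∧
          ((G (st k) : Finset E) : Set E) ⊆ ω), a k} =
        {ω : Set E | j + 1 ≤ ∑ k ∈ Finset.univ.filter (fun k => lv k ≤ 0 ∧ ((G k : Finset E) : Set E) ⊆ ω ∧
          ((G (st k) : Finset E) : Set E) ⊆ ω), a k} := by
      ext ω
      simp only [Set.mem_setOf_eq]
      have : Finset.univ.filter (fun k => (∀ i : Fin 0, (i : ℕ) < lv k → ch i ∈ ω) ∧ ((G k : Finset E) : Set E) ⊆ ω ∧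
            ((G (st k) : Finset E) : Set E) ⊆ ω) =
          Finset.univ.filter (fun k => lv k ≤ 0 ∧ ((G k : Finset E) : Set E) ⊆ ω ∧ ((G (st k) : Finset E) : Set E) ⊆ ω) := by
        ext k
        simp only [Finset.mem_filter, Finset.mem_univ, true_and, IsEmpty.forall_iff]
        exact ⟨fun h => ⟨(hlv0 k).le, h⟩, fun h => h.2⟩
      rw [this]
    rw [hev, real_pieceCount_eq_sum q G hGdisj lv a st 0 j, Finset.sum_range_one]
    have hpd : pd[0, (fun i => if h : i < 0 then ((q (ch ⟨i, h⟩) : unitInterval) : ℝ) else 1), 0] = 1 := by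
      show (∏ i' ∈ Finset.range 0, (fun i => if h : i < 0 then ((q (ch ⟨i, h⟩) : unitInterval) : ℝ) else 1) i') *
        (if 0 < 0 then 1 - (fun i => if h : i < 0 then ((q (ch ⟨i, h⟩) : unitInterval) : ℝ) else 1) 0 else (1 : ℝ)) = 1
      rw [Finset.prod_range_zero, if_neg (lt_irrefl 0), one_mul]
    rw [hpd, one_mul]
  | succ D ih =>
    intro q ch hch G hGdisj hGch lv hlv a st j
    set e₀ : E := ch 0 with he₀
    set H : Set (Set E) := {ω : Set E | j + 1 ≤ ∑ k ∈ Finset.univ.filter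
        (fun k => (∀ i : Fin (D + 1), (i : ℕ) < lv k → ch i ∈ ω) ∧ ((G k : Finset E) : Set E) ⊆ ω ∧
          ((G (st k) : Finset E) : Set E) ⊆ ω), a k} with hH
    have hch'inj : Function.Injective (fun i : Fin D => ch i.succ) := fun i i' h => Fin.succ_injective _ (hch h)
    have hGch' : ∀ k (i : Fin D), (fun i : Fin D => ch i.succ) i ∉ G k := fun k i => hGch k i.succ
    have hlv' : ∀ k, (fun k => lv k - 1) k ≤ D := fun k => by have := hlv k; simp only; omega
    have he₀G : ∀ k, e₀ ∉ G k := fun k => hGch k 0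
    have he₀ch' : ∀ i : Fin D, ch i.succ ≠ e₀ := fun i h => Fin.succ_ne_zero i (hch h)
    have hdet : DeterminedBy H (↑(Finset.univ : Finset E) : Set E) := by
      rw [determinedBy_iff]; intro ω ω' h
      simp only [Finset.coe_univ, Set.inter_univ] at h; rw [h]
    -- a private set is insensitive to the top chain gate
    have hGins : ∀ k (ω : Set E), ((G k : Finset E) : Set E) ⊆ insert e₀ ω ↔ ((G k : Finset E) : Set E) ⊆ ω := by
      intro k ω
      constructor
      · intro h e he
        rcases Set.mem_insert_iff.1 (h he) with h1 | h1
        · exact absurd (Finset.mem_coe.1 he) (h1 ▸ he₀G k)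
        · exact h1
      · intro h e he; exact Set.mem_insert_of_mem _ (h he)
    have hGdel : ∀ k (ω : Set E), ((G k : Finset E) : Set E) ⊆ ω \ {e₀} ↔ ((G k : Finset E) : Set E) ⊆ ω := by
      intro k ω
      constructor
      · intro h e he; exact (h he).1
      · intro h e he
        exact ⟨h he, fun h1 => he₀G k ((Set.mem_singleton_iff.1 h1) ▸ Finset.mem_coe.1 he)⟩
    -- top gate OPEN: the event becomes the heavy event of the shifted chain
    have hopen : {ω : Set E | insert e₀ ω ∈ H} = {ω : Set E | j + 1 ≤ ∑ k ∈ Finset.univ.filter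
        (fun k => (∀ i : Fin D, (i : ℕ) < lv k - 1 → ch i.succ ∈ ω) ∧ ((G k : Finset E) : Set E) ⊆ ω ∧
          ((G (st k) : Finset E) : Set E) ⊆ ω), a k} := by
      ext ω
      simp only [hH, Set.mem_setOf_eq]
      have hPQ : ∀ k, ((∀ i : Fin (D + 1), (i : ℕ) < lv k → ch i ∈ insert e₀ ω) ∧
            ((G k : Finset E) : Set E) ⊆ insert e₀ ω ∧ ((G (st k) : Finset E) : Set E) ⊆ insert e₀ ω) ↔
          ((∀ i : Fin D, (i : ℕ) < lv k - 1 → ch i.succ ∈ ω) ∧ ((G k : Finset E) : Set E) ⊆ ω ∧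
            ((G (st k) : Finset E) : Set E) ⊆ ω) := by
        intro k
        have hC : (∀ i : Fin (D + 1), (i : ℕ) < lv k → ch i ∈ insert e₀ ω) ↔
            (∀ i : Fin D, (i : ℕ) < lv k - 1 → ch i.succ ∈ ω) := by
          constructor
          · intro h i hi
            have hlt : ((i.succ : Fin (D + 1)) : ℕ) < lv k := by rw [Fin.val_succ]; omega
            rcases Set.mem_insert_iff.1 (h i.succ hlt) with h2 | h2
            · exact absurd h2 (he₀ch' i)
            · exact h2
          · intro h i hi
            rcases Fin.eq_zero_or_eq_succ i with h0 | ⟨i', rfl⟩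
            · rw [h0]; exact Set.mem_insert _ _
            · refine Set.mem_insert_of_mem _ (h i' ?_)
              have : ((i'.succ : Fin (D + 1)) : ℕ) = (i' : ℕ) + 1 := Fin.val_succ i'
              omega
        exact hC.and ((hGins k ω).and (hGins (st k) ω))
      apply Iff.of_eq
      congr 1
      refine Finset.sum_congr ?_ fun _ _ => rfl
      ext k
      simp only [Finset.mem_filter, Finset.mem_univ, true_and]
      exact hPQ k
    -- top gate CLOSED: only the root-level pieces count
    have hclosed : {ω : Set E | ω \ {e₀} ∈ H} =
        {ω : Set E | j + 1 ≤ ∑ k ∈ Finset.univ.filter (fun k => lv k ≤ 0 ∧ ((G k : Finset E) : Set E) ⊆ ω ∧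
          ((G (st k) : Finset E) : Set E) ⊆ ω), a k} := by
      ext ω
      simp only [hH, Set.mem_setOf_eq]
      have hPQ : ∀ k, ((∀ i : Fin (D + 1), (i : ℕ) < lv k → ch i ∈ ω \ {e₀}) ∧
            ((G k : Finset E) : Set E) ⊆ ω \ {e₀} ∧ ((G (st k) : Finset E) : Set E) ⊆ ω \ {e₀}) ↔
          (lv k ≤ 0 ∧ ((G k : Finset E) : Set E) ⊆ ω ∧ ((G (st k) : Finset E) : Set E) ⊆ ω) := by
        intro k
        have hC : (∀ i : Fin (D + 1), (i : ℕ) < lv k → ch i ∈ ω \ {e₀}) ↔ lv k ≤ 0 := by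
          constructor
          · intro h
            by_contra hne
            have hlt : ((0 : Fin (D + 1)) : ℕ) < lv k := by simp only [Fin.val_zero]; omega
            exact (h 0 hlt).2 (Set.mem_singleton _)
          · intro h i hi; omega
        exact hC.and ((hGdel k ω).and (hGdel (st k) ω))
      apply Iff.of_eq
      congr 1
      refine Finset.sum_congr ?_ fun _ _ => rfl
      ext k
      simp only [Finset.mem_filter, Finset.mem_univ, true_and]
      exact hPQ k
    -- the three probabilities
    have hA : (prodBernoulli q).real {ω : Set E | insert e₀ ω ∈ H} =
        TAILst[D, (fun i => if h : i < D then ((q (ch (Fin.succ ⟨i, h⟩)) : unitInterval) : ℝ) else 1),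
          (fun k => lv k - 1), a, (fun k => ∏ e ∈ G k, (q e : ℝ)), st, j] := by
      rw [hopen]
      exact ih q (fun i : Fin D => ch i.succ) hch'inj G hGdisj hGch' (fun k => lv k - 1) hlv' a st j
    have hB : (prodBernoulli q).real {ω : Set E | ω \ {e₀} ∈ H} =
        ∑ S : Finset κ, wt[(fun k => ∏ e ∈ G k, (q e : ℝ)), S] * (if j + 1 ≤ massSt[lv, a, st, 0, S] then (1 : ℝ) else 0) := by
      rw [hclosed]
      exact real_pieceCount_eq_sum q G hGdisj lv a st 0 j
    have hsplit := prodBernoulli_real_gate_split q e₀ H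
    rw [prodBernoulli_real_update_one_eq hdet q (Finset.mem_univ e₀),
      prodBernoulli_real_update_zero_eq hdet q (Finset.mem_univ e₀), hA, hB] at hsplit
    rw [hsplit]
    have hT := tailSt_succ D (fun i => if h : i < D + 1 then ((q (ch ⟨i, h⟩) : unitInterval) : ℝ) else 1) lv a
      (fun k => ∏ e ∈ G k, (q e : ℝ)) st j
    have hchain : (fun i => if h : i + 1 < D + 1 then ((q (ch ⟨i + 1, h⟩) : unitInterval) : ℝ) else 1) =
        (fun i => if h : i < D then ((q (ch (Fin.succ ⟨i, h⟩)) : unitInterval) : ℝ) else 1) := by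
      funext i
      by_cases h : i < D
      · have h' : i + 1 < D + 1 := Nat.succ_lt_succ h
        rw [dif_pos h', dif_pos h]
        rfl
      · have h' : ¬ (i + 1 < D + 1) := fun h'' => h (Nat.lt_of_succ_lt_succ h'')
        rw [dif_neg h', dif_neg h]
    have hz : (⟨0, Nat.succ_pos D⟩ : Fin (D + 1)) = 0 := by ext; simp
    have hq0 : (if h : 0 < D + 1 then ((q (ch ⟨0, h⟩) : unitInterval) : ℝ) else 1) = ((q e₀ : unitInterval) : ℝ) := by
      rw [dif_pos (Nat.succ_pos D), hz]
    rw [hT, hchain, hq0]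
    ring

/-! ### 4. The cherry-comb row, gate coordinates -/

/-- **THE CHERRY-COMB ROW, gate coordinates.**  Independent gates `q : E → [0,1]`; chain `ch : Fin D → E` (injective); pieces with pairwise
disjoint private gate sets `G k` off the chain, levels `lv k ≤ D`, class sizes `a k` and stems `st k` (stemless, `st (st k) = st k`, at the level
of their leaves); every leaf `k` (`st k ≠ k`) in a unit cherry (`a (st k) = 0`, exactly one partner leaf `k' ≠ k` with `a k' = a k`).  Piece `k`
is reached when the chain prefix of length `lv k`, all of `G k` and all of `G (st k)` are open, contributing `a k` relays.  If
`2j < Σ_k a k·marginal k` and `1 − marginal k ≤ t` for every live piece (marginal `= (∏_{i<lv k} q(ch i))·∏_{G k} q` for a blob,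
`(∏_{i<lv k} q(ch i))·(∏_{G (st k)} q)·∏_{G k} q` for a leaf), then `P(Σ_{k reached} a k ≤ j) ≤ t`.
Proof: `real_heavy_eq_tailSt` + `Quant.CherryComb.tail_ge_of_cherryComb`. [this work] -/
theorem farTree_cherryComb_of_mean (q : E → unitInterval) (D : ℕ) (ch : Fin D → E) (hch : Function.Injective ch)
    (G : κ → Finset E) (hGdisj : ∀ k k', k ≠ k' → Disjoint (G k) (G k')) (hGch : ∀ k (i : Fin D), ch i ∉ G k)
    (lv : κ → ℕ) (hlv : ∀ k, lv k ≤ D) (a : κ → ℕ) (st : κ → κ) (hstem : ∀ k, st (st k) = st k)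
    (hlvst : ∀ k, lv (st k) = lv k)
    (hcherry : ∀ k, st k ≠ k → a (st k) = 0 ∧ ∃ k', k' ≠ k ∧ k' ≠ st k ∧ st k' = st k ∧ a k' = a k ∧
      ∀ k'', st k'' = st k → k'' = st k ∨ k'' = k ∨ k'' = k')
    (j : ℕ) (t : ℝ)
    (hmean : (2 * j : ℝ) < ∑ k, (a k : ℝ) *
      ((∏ i ∈ Finset.range (lv k), (if h : i < D then ((q (ch ⟨i, h⟩) : unitInterval) : ℝ) else 1)) *
        (if st k = k then ∏ e ∈ G k, (q e : ℝ) else (∏ e ∈ G (st k), (q e : ℝ)) * ∏ e ∈ G k, (q e : ℝ))))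
    (ht : ∀ k, 0 < a k →
      1 - (∏ i ∈ Finset.range (lv k), (if h : i < D then ((q (ch ⟨i, h⟩) : unitInterval) : ℝ) else 1)) *
        (if st k = k then ∏ e ∈ G k, (q e : ℝ) else (∏ e ∈ G (st k), (q e : ℝ)) * ∏ e ∈ G k, (q e : ℝ)) ≤ t) :
    (prodBernoulli q).real {ω : Set E | ∑ k ∈ Finset.univ.filter
        (fun k => (∀ i : Fin D, (i : ℕ) < lv k → ch i ∈ ω) ∧ ((G k : Finset E) : Set E) ⊆ ω ∧
          ((G (st k) : Finset E) : Set E) ⊆ ω), a k ≤ j} ≤ t := by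
  set H : Set (Set E) := {ω : Set E | j + 1 ≤ ∑ k ∈ Finset.univ.filter
        (fun k => (∀ i : Fin D, (i : ℕ) < lv k → ch i ∈ ω) ∧ ((G k : Finset E) : Set E) ⊆ ω ∧
          ((G (st k) : Finset E) : Set E) ⊆ ω), a k} with hH
  have hcompl : {ω : Set E | ∑ k ∈ Finset.univ.filter
        (fun k => (∀ i : Fin D, (i : ℕ) < lv k → ch i ∈ ω) ∧ ((G k : Finset E) : Set E) ⊆ ω ∧
          ((G (st k) : Finset E) : Set E) ⊆ ω), a k ≤ j} = Hᶜ := by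
    ext ω; simp only [hH, Set.mem_setOf_eq, Set.mem_compl_iff, not_le]; omega
  have hheavy : (prodBernoulli q).real H =
      TAILst[D, (fun i => if h : i < D then ((q (ch ⟨i, h⟩) : unitInterval) : ℝ) else 1), lv, a,
        (fun k => ∏ e ∈ G k, (q e : ℝ)), st, j] :=
    real_heavy_eq_tailSt D q ch hch G hGdisj hGch lv hlv a st j
  rw [hcompl, probReal_compl_eq_one_sub MeasurableSet.of_discrete, hheavy]
  set qc : ℕ → ℝ := fun i => if h : i < D then ((q (ch ⟨i, h⟩) : unitInterval) : ℝ) else 1 with hqc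
  set g : κ → ℝ := fun k => ∏ e ∈ G k, (q e : ℝ) with hg
  have hqc01 : ∀ i, 0 ≤ qc i ∧ qc i ≤ 1 := fun i => by
    by_cases h : i < D
    · simp only [hqc, dif_pos h]; exact ⟨(q _).2.1, (q _).2.2⟩
    · simp only [hqc, dif_neg h]; norm_num
  have hg01 : ∀ k, 0 ≤ g k ∧ g k ≤ 1 := fun k =>
    ⟨Finset.prod_nonneg fun e _ => (q e).2.1, Finset.prod_le_one (fun e _ => (q e).2.1) fun e _ => (q e).2.2⟩
  have hx : ∀ k, 0 < a k → 1 - t ≤ (∏ i ∈ Finset.range (lv k), qc i) * (if st k = k then g k else g (st k) * g k) :=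
    fun k hk => by have := ht k hk; linarith
  have key := CherryComb.tail_ge_of_cherryComb D qc hqc01 lv a g hg01 st hstem hlvst hcherry j (fun k _ => hlv k) (1 - t) hx hmean
  linarith

end CherryCombGate

end Quant

end Summit.CriticalPhenomena.PercolationContinuityZ3.Theorems
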